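import Literature.AlgebraicGeometry.Resolution.Dehomogenization
import Mathlib.Algebra.MvPolynomial.NoZeroDivisors
import Mathlib.RingTheory.Polynomial.UniqueFactorization
import Mathlib.RingTheory.Polynomial.RationalRoot
import Mathlib.RingTheory.IntegralClosure.IntegrallyClosed
import HarnessLib

/-!
# Crux `Steer` (stmt-ResolutionOfSingularities-16345), chain W4.1, hARᵒ slot S1a (`VisitLawAt`): **forms — homogenization, square
# descent of an initial form from its dehomogenization, and prime-power bookkeeping** (FILE 2a of res-type-096's staged plan, plan-1
# RULING 132a/140c; pure polynomial algebra feeding the exceptional-order theorem `clord_x f' = ν − 2`)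

OURS (campaign `res-hironaka`, rung L ★L-G4, slot W4.1; seat res-type-096 g9; NOT a statement of the manuscript under review
[claim: Hironaka2017, status: under-review]; AI-produced, weaker than expert review). Definition-free, Theses-free.

* `exists_isHomogeneous_dehomogenize_eq` — HOMOGENIZATION: a polynomial `q ∈ R[T_j : j ≠ i]` of total degree `≤ m` is
  `Q(T_i := 1)` for a form `Q ∈ R[T]` of degree `m` (the tree's `Dehomogenization.lean` has the other direction only).
* `exists_isHomogeneous_map_eq` — a form over `S` lifts to a form of the same degree along a surjection `R → S`.
* `eq_X_pow_mul_sq_of_dehomogenize_eq_sq` — SQUARE DESCENT: over a field, if the dehomogenization of a form `F` of degree `ν`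
  is a square `q²`, then `F = T_i ^ (ν % 2) · Q²` for a form `Q` of degree `ν / 2` (degree count `2·deg q ≤ ν`, homogenize `q`,
  injectivity of dehomogenization on forms of one degree).
* `exists_eq_sq_of_mul_sq_eq_sq` — in an integrally closed domain `g·b² = a²`, `b ≠ 0` ⇒ `g` is a square
  (`IsIntegrallyClosed.pow_dvd_pow_iff`); used for `k[T]`, a UFD.
* `pow_dvd_of_pow_two_mul_dvd_sq`, `pow_succ_dvd_of_pow_two_mul_succ_dvd_sq` — for a prime `x` of a domain,
  `x^(2k) ∣ z²` ⇒ `x^k ∣ z` and `x^(2k+1) ∣ z²` ⇒ `x^(k+1) ∣ z`.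

[folklore]
-/

noncomputable section

-- `Summit.<S>.<S>.…` duplicates the summit name by design (single-problem summit).
set_option linter.dupNamespace false

namespace Summit.ResolutionOfSingularities.ResolutionOfSingularities.Theorems.SwitchingDichotomy

open Literature.AlgebraicGeometry.Resolution MvPolynomial

namespace VisitLaw

/-! ## Homogenization -/

/-- **Homogenization.** A polynomial `q` in the variables `T_j`, `j ≠ i`, of total degree `≤ m` is the dehomogenization
`Q(T_i := 1)` of a form `Q` of degree `m` in all the variables (pad each monomial with the missing power of `T_i`). [folklore] -/
theorem exists_isHomogeneous_dehomogenize_eq {R : Type*} [CommRing R] {σ : Type*} [DecidableEq σ] (i : σ)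
    (q : MvPolynomial {j : σ // j ≠ i} R) {m : ℕ} (hq : q.totalDegree ≤ m) :
    ∃ Q : MvPolynomial σ R, Q.IsHomogeneous m ∧ dehomogenize i Q = q := by
  classical
  -- the padded exponent of a monomial `β` of `q`
  let ext : ({j : σ // j ≠ i} →₀ ℕ) → (σ →₀ ℕ) := fun β =>
    β.mapDomain Subtype.val + Finsupp.single i (m - Finsupp.degree β)
  have hext : ∀ β : {j : σ // j ≠ i} →₀ ℕ, (ext β).subtypeDomain (· ≠ i) = β := by
    intro β
    ext j
    rw [Finsupp.subtypeDomain_apply]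
    change (β.mapDomain Subtype.val + Finsupp.single i (m - Finsupp.degree β)) j.1 = β j
    rw [Finsupp.add_apply, Finsupp.mapDomain_apply Subtype.val_injective, Finsupp.single_eq_of_ne j.2,
      add_zero]
  have hdeg : ∀ β ∈ q.support, Finsupp.degree (ext β) = m := by
    intro β hβ
    have hβm : Finsupp.degree β ≤ m := (MvPolynomial.le_totalDegree hβ).trans hq
    change Finsupp.degree (β.mapDomain Subtype.val + Finsupp.single i (m - Finsupp.degree β)) = m
    rw [map_add, Finsupp.degree_mapDomain, Finsupp.degree_single]
    omega
  refine ⟨∑ β ∈ q.support, monomial (ext β) (coeff β q), ?_, ?_⟩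
  · exact IsHomogeneous.sum _ _ _ fun β hβ => isHomogeneous_monomial _ (hdeg β hβ)
  · rw [map_sum]
    conv_rhs => rw [q.as_sum]
    refine Finset.sum_congr rfl fun β _ => ?_
    rw [dehomogenize_monomial, hext]

/-- **Lifting a form along a surjection of coefficient rings**, degree preserved (lift each coefficient). [folklore] -/
theorem exists_isHomogeneous_map_eq {R S : Type*} [CommRing R] [CommRing S] {σ : Type*} (f : R →+* S)
    (hf : Function.Surjective f) {P : MvPolynomial σ S} {m : ℕ} (hP : P.IsHomogeneous m) :
    ∃ Q : MvPolynomial σ R, Q.IsHomogeneous m ∧ MvPolynomial.map f Q = P := by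
  classical
  refine ⟨∑ α ∈ P.support, monomial α (Function.surjInv hf (coeff α P)), ?_, ?_⟩
  · refine IsHomogeneous.sum _ _ _ fun α hα => isHomogeneous_monomial _ ?_
    by_contra hne
    exact (MvPolynomial.mem_support_iff.mp hα) (hP.coeff_eq_zero hne)
  · rw [map_sum]
    conv_rhs => rw [P.as_sum]
    refine Finset.sum_congr rfl fun α _ => ?_
    rw [map_monomial, Function.surjInv_eq hf]

/-! ## Square descent from the dehomogenization -/

/-- **Square descent.** Over a field: if the dehomogenization `F(T_i := 1)` of a form `F` of degree `ν` is a square `q²`, then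
`F = T_i ^ (ν % 2) · Q²` for a form `Q` of degree `ν / 2`. (If `F ≠ 0`: `2·deg q = deg q² ≤ deg F = ν`; homogenize `q` to degree
`ν / 2`; `F − T_i^(ν % 2)·Q²` is a form of degree `ν` killed by `T_i := 1`, hence zero.) [folklore] -/
theorem eq_X_pow_mul_sq_of_dehomogenize_eq_sq {k : Type*} [Field k] {σ : Type*} [DecidableEq σ] (i : σ)
    {F : MvPolynomial σ k} {ν : ℕ} (hF : F.IsHomogeneous ν) (q : MvPolynomial {j : σ // j ≠ i} k)
    (h : dehomogenize i F = q ^ 2) :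
    ∃ Q : MvPolynomial σ k, Q.IsHomogeneous (ν / 2) ∧ F = X i ^ (ν % 2) * Q ^ 2 := by
  classical
  by_cases hF0 : F = 0
  · exact ⟨0, isHomogeneous_zero _ _ _, by rw [hF0]; simp⟩
  have hq0 : q ≠ 0 := by
    intro hq
    apply dehomogenize_ne_zero_of_isHomogeneous i hF hF0
    rw [h, hq, zero_pow two_ne_zero]
  -- degree count
  have hdeg : q.totalDegree ≤ ν / 2 := by
    have h2 : (q ^ 2).totalDegree = q.totalDegree + q.totalDegree := by
      rw [pow_two, totalDegree_mul_of_isDomain hq0 hq0]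
    have hle : (q ^ 2).totalDegree ≤ ν := by
      rw [← h]
      exact (totalDegree_dehomogenize_le i F).trans hF.totalDegree_le
    omega
  obtain ⟨Q, hQ, hQq⟩ := exists_isHomogeneous_dehomogenize_eq i q hdeg
  refine ⟨Q, hQ, ?_⟩
  -- `G := F − T_i^(ν % 2) Q²` is a form of degree `ν` with `G(T_i := 1) = 0`
  have hXQ : (X i ^ (ν % 2) * Q ^ 2 : MvPolynomial σ k).IsHomogeneous ν := by
    have h1 : (X i ^ (ν % 2) * Q ^ 2 : MvPolynomial σ k).IsHomogeneous (1 * (ν % 2) + ν / 2 * 2) :=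
      ((isHomogeneous_X k i).pow (ν % 2)).mul (hQ.pow 2)
    have h2 : 1 * (ν % 2) + ν / 2 * 2 = ν := by omega
    rwa [h2] at h1
  have hG : (F - X i ^ (ν % 2) * Q ^ 2).IsHomogeneous ν := hF.sub hXQ
  have hG0 : dehomogenize i (F - X i ^ (ν % 2) * Q ^ 2) = 0 := by
    rw [map_sub, map_mul, map_pow, map_pow, hQq, h]
    have : dehomogenize i (X i : MvPolynomial σ k) = 1 := by
      rw [MvPolynomial.aeval_X, killVar_self]
    rw [this, one_pow, one_mul, sub_self]
  by_contra hne
  exact dehomogenize_ne_zero_of_isHomogeneous i hG (sub_ne_zero.mpr hne) hG0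

/-! ## Squares in integrally closed domains -/

/-- In an integrally closed domain, `g · b² = a²` with `b ≠ 0` forces `g` to be a square (`b² ∣ a²` ⇒ `b ∣ a`). Used for the
polynomial ring `k[T]` over a field (a UFD). [folklore] -/
theorem exists_eq_sq_of_mul_sq_eq_sq {A : Type*} [CommRing A] [IsDomain A] [IsIntegrallyClosed A] {g a b : A}
    (hb : b ≠ 0) (h : g * b ^ 2 = a ^ 2) : ∃ q : A, g = q ^ 2 := by
  have hdvd : b ^ 2 ∣ a ^ 2 := ⟨g, by rw [← h, mul_comm]⟩
  obtain ⟨q, hq⟩ := (IsIntegrallyClosed.pow_dvd_pow_iff two_ne_zero).mp hdvd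
  refine ⟨q, mul_right_cancel₀ (pow_ne_zero 2 hb) ?_⟩
  rw [h, hq, mul_pow, mul_comm]

/-- The polynomial ring in any set of variables over a field is an integrally closed domain (it is a UFD). [folklore] -/
theorem isIntegrallyClosed_mvPolynomial (k : Type*) [Field k] (σ : Type*) :
    IsIntegrallyClosed (MvPolynomial σ k) :=
  inferInstance

/-! ## Prime powers dividing a square -/

/-- For a prime `x` of a domain: `x ^ (2k) ∣ z²` ⇒ `x ^ k ∣ z`. [folklore] -/
theorem pow_dvd_of_pow_two_mul_dvd_sq {A : Type*} [CommRing A] [IsDomain A] {x : A} (hx : Prime x) :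
    ∀ (k : ℕ) (z : A), x ^ (2 * k) ∣ z ^ 2 → x ^ k ∣ z := by
  intro k
  induction k with
  | zero => intro z _; simp
  | succ k ih =>
    intro z hz
    have h1 : x ∣ z ^ 2 := (dvd_pow_self x (by omega : 2 * (k + 1) ≠ 0)).trans hz
    obtain ⟨z₁, rfl⟩ := hx.dvd_of_dvd_pow h1
    have h2 : x ^ (2 * k) ∣ z₁ ^ 2 := by
      have e : x ^ (2 * (k + 1)) = x ^ 2 * x ^ (2 * k) := by ring
      rw [e, mul_pow] at hz
      exact (mul_dvd_mul_iff_left (pow_ne_zero 2 hx.ne_zero)).mp hz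
    obtain ⟨w, hw⟩ := ih z₁ h2
    exact ⟨w, by rw [hw]; ring⟩

/-- For a prime `x` of a domain: `x ^ (2k+1) ∣ z²` ⇒ `x ^ (k+1) ∣ z` (the `x`-order of a square is even). [folklore] -/
theorem pow_succ_dvd_of_pow_two_mul_succ_dvd_sq {A : Type*} [CommRing A] [IsDomain A] {x : A} (hx : Prime x)
    (k : ℕ) (z : A) (hz : x ^ (2 * k + 1) ∣ z ^ 2) : x ^ (k + 1) ∣ z := by
  have h1 : x ^ (2 * k) ∣ z ^ 2 := (pow_dvd_pow x (Nat.le_succ _)).trans hz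
  obtain ⟨z₁, rfl⟩ := pow_dvd_of_pow_two_mul_dvd_sq hx k z h1
  have h2 : x ∣ z₁ ^ 2 := by
    have e : (x ^ k * z₁) ^ 2 = x ^ (2 * k) * z₁ ^ 2 := by ring
    rw [e, pow_succ] at hz
    exact (mul_dvd_mul_iff_left (pow_ne_zero _ hx.ne_zero)).mp hz
  obtain ⟨w, rfl⟩ := hx.dvd_of_dvd_pow h2
  exact ⟨w, by ring⟩

end VisitLaw

end Summit.ResolutionOfSingularities.ResolutionOfSingularities.Theorems.SwitchingDichotomy

end
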